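import Mathlib
import Summits.Ventures.PercRepro2.TypedPendant
import Summits.Ventures.PercRepro2.TypedSeries
import Summits.Ventures.PercRepro2.TypedTwoEdgesAtOKernel

/-!
# The two-edge `o` at `a₃`, I: inert copies and the states of a two-edge `o` (blind cell
PercRepro2, mine-2 g53, 2026-08-29; `conjectures/MINE-2.md` M2-111)

The kernel `K₃` carries the mark `o` in exactly one copy per term (`KB = KOx + KOy + KOz`,
`TypedPendant.lean`).  The `o`-terms of a copy vanish POINTWISE whenever `o` is isolated there or
carries the side data of `a₃` in THAT copy (`KOx_eq_zero_of_oInert`, …: the per-copy form of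
night-3's `o = a₃` coincidence, `TypedCoincidence.lean`; night-3 g16's `KB_oa3_x/y/z` of
`TypedOA3Edge.lean` is the coincident case with the other two copies killed), and they do not see
the `o`-data of the other copies (night-3 g16's `KOx_killO_y`, …, `TypedTwoEdgesAtOKernel.lean`,
imported).  For a mark `o` with exactly the two edges `g₁ = {o, v}` and
`g₂ = {o, a₃}` this makes every copy `o`-inert unless `g₁` is open and `g₂` closed in it
(`st_oInert`): an `o` hanging at `a₃` alone is inert, and a copy in which `o` bridges `v` and `a₃`
carries no `o`-term.  The configuration lemmas (`killO_st_update_g₂`, `st_update_g₁_of_closed`)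
record that the non-`o` data does not see `g₂` when `g₁` is closed, and that closing `g₁` with `g₂`
closed is the kill `killO`.  Bookkeeping: the copy swap `typedCount_swap13'` (no type hypothesis)
and the `Bool³` sum `sum_bool3_first_closed`.  The reduction theorem is in `TypedTwoEdgeO.lean`.
Own work; standard axioms.
-/

namespace Summit.Ventures.PercRepro2

namespace CovForm

namespace TypedRed

open OneTyped

/-! ## The `o`-terms of a copy vanish when `o` is inert there -/

section States

/-- `σ_v · 1_{v ∈ U} = σ_v`. -/
lemma sigB_mul_uB (L H : Bool) : sigB L H * uB L H = sigB L H := by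
  cases L <;> cases H <;> simp [sigB, uB]

/-- `1_PD · 1_{a₃ ∈ U} = 0`. -/
lemma pdB_mul_uB3 (s : St) : pdB s * uB s.L3 s.H3 = 0 := by
  obtain ⟨q, Lo, Ho, Lb, Hb, L3, H3⟩ := s
  cases q <;> cases L3 <;> cases H3 <;> simp [pdB, uB, St.q', St.L3, St.H3]

/-- `1_PD · 1_{o ∈ U} = 0` on an `o`-INERT state (`o` isolated, or carrying the side data of
`a₃`). -/
lemma pdB_mul_uB_of_oInert (s : St)
    (h : (s.Lo = false ∧ s.Ho = false) ∨ (s.Lo = s.L3 ∧ s.Ho = s.H3)) :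
    pdB s * uB s.Lo s.Ho = 0 := by
  rcases h with ⟨h1, h2⟩ | ⟨h1, h2⟩
  · rw [h1, h2, uB_ff, mul_zero]
  · rw [h1, h2]; exact pdB_mul_uB3 s

/-- The `o`-term of the first copy vanishes when that copy is inert. -/
lemma KOx_eq_zero_of_oInert (x y z : St)
    (h : (x.Lo = false ∧ x.Ho = false) ∨ (x.Lo = x.L3 ∧ x.Ho = x.H3)) : KOx x y z = 0 := by
  unfold KOx; rw [pdB_mul_uB_of_oInert x h]; ring

/-- The `o`-term of the second copy vanishes when that copy is inert. -/
lemma KOy_eq_zero_of_oInert (x y z : St)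
    (h : (y.Lo = false ∧ y.Ho = false) ∨ (y.Lo = y.L3 ∧ y.Ho = y.H3)) : KOy x y z = 0 := by
  unfold KOy; rw [pdB_mul_uB_of_oInert y h]; ring

/-- The `o`-terms of the third copy vanish when that copy is inert. -/
lemma KOz_eq_zero_of_oInert (x y z : St)
    (h : (z.Lo = false ∧ z.Ho = false) ∨ (z.Lo = z.L3 ∧ z.Ho = z.H3)) : KOz x y z = 0 := by
  obtain ⟨q, Lo, Ho, Lb, Hb, L3, H3⟩ := z
  simp only [St.Lo, St.Ho, St.L3, St.H3] at h
  rcases h with ⟨rfl, rfl⟩ | ⟨rfl, rfl⟩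
  · simp only [KOz, St.Lo, St.Ho, sigB_ff, uB_ff]; ring
  · cases q <;> cases Lo <;> cases Ho <;> cases Lb <;> cases Hb <;>
      simp [KOz, pdB, qB, sigB, uB, St.q', St.Lo, St.Ho, St.Lb, St.Hb, St.L3, St.H3]

/-- `killO` is idempotent. -/
lemma killO_killO (s : St) : killO (killO s) = killO s := rfl

end States

/-! ## Bookkeeping: the third copy swapped with the first, and a `Bool³` sum -/

section Book

variable {E : Type*} [Fintype E] [DecidableEq E] {R : Type*} [CommRing R]

/-- Swapping the first and third copies does not change a typed count. -/
lemma typedCount_swap13' (F : Finset E) (z : Config E) (τ : E → ℕ)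
    (K : Config E → Config E → Config E → R) :
    typedCount F z τ (fun x y w => K w y x) = typedCount F z τ K := by
  unfold typedCount
  have h : ∀ x y w : Config E,
      (if (∀ e, e ∉ F → x e = z e ∧ y e = z e ∧ w e = z e) ∧
          (∀ e ∈ F, openCount x y w e = τ e) then K w y x else 0) =
      (if (∀ e, e ∉ F → w e = z e ∧ y e = z e ∧ x e = z e) ∧
          (∀ e ∈ F, openCount w y x e = τ e) then K w y x else 0) := by
    intro x y w
    refine if_congr ?_ rfl rfl
    have h1 : (∀ e, e ∉ F → x e = z e ∧ y e = z e ∧ w e = z e) ↔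
        (∀ e, e ∉ F → w e = z e ∧ y e = z e ∧ x e = z e) := by
      constructor <;> intro h e he <;> obtain ⟨h1, h2, h3⟩ := h e he <;> exact ⟨h3, h2, h1⟩
    have h2 : (∀ e ∈ F, openCount x y w e = τ e) ↔ (∀ e ∈ F, openCount w y x e = τ e) := by
      constructor <;> intro h e he <;> rw [← h e he] <;> unfold openCount <;> ring
    rw [h1, h2]
  rw [Finset.sum_comm]
  refine (Finset.sum_congr rfl fun y _ => Finset.sum_comm).trans ?_
  rw [Finset.sum_comm]
  refine Finset.sum_congr rfl fun w _ => Finset.sum_congr rfl fun y _ =>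
    Finset.sum_congr rfl fun x _ => ?_
  exact h x y w

/-- `Σ_{(a,b,c) ∈ Bool³, a+b+c = k} [a = false] T = C(2,k) · T`. -/
lemma sum_bool3_first_closed (k : ℕ) (T : R) :
    (∑ a : Bool, ∑ b : Bool, ∑ c : Bool, if a.toNat + b.toNat + c.toNat = k then
        (if a = false then T else 0) else 0) = (Nat.choose 2 k : R) * T := by
  simp only [Fintype.sum_bool, Bool.toNat_true, Bool.toNat_false, Bool.true_eq_false, if_false,
    if_true]
  rcases k with _ | _ | _ | k
  · norm_num
  · norm_num [Nat.choose]
    ring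
  · norm_num [Nat.choose]
  · rw [Nat.choose_eq_zero_of_lt (by omega)]
    norm_num

end Book

/-! ## The states of a configuration at a two-edge `o` -/

section Config

open Classical

variable {V : Type*} {E : Type*} [Fintype E] [DecidableEq E]
variable (ends : E → Sym2 V) (o a₁ a₂ a₃ b : V)

omit [Fintype E] [DecidableEq E] in
/-- With `g₂ = {o, a₃}` open, `o` carries the side data of `a₃`. -/
lemma st_coinc_of_open {g₂ : E} (hg₂ : ends g₂ = s(o, a₃)) (x : Config E) (hx : x g₂ = true) :
    (st ends o a₁ a₂ a₃ b x).Lo = (st ends o a₁ a₂ a₃ b x).L3 ∧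
      (st ends o a₁ a₂ a₃ b x).Ho = (st ends o a₁ a₂ a₃ b x).H3 := by
  have key : ∀ p : V, Conn ends x p o ↔ Conn ends x p a₃ := fun p =>
    ⟨fun h => conn_symm ((conn_leaf_open hg₂ hx).1 (conn_symm h)),
     fun h => conn_symm ((conn_leaf_open hg₂ hx).2 (conn_symm h))⟩
  exact ⟨decide_eq_decide.mpr (key a₁), decide_eq_decide.mpr (key a₂)⟩

omit [Fintype E] in
/-- With both edges of a two-edge `o` closed, `o` is isolated. -/
lemma st_isolated_of_closed {g₁ g₂ : E} {v : V} (hg₁ : ends g₁ = s(o, v))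
    (hg₂ : ends g₂ = s(o, a₃)) (hdeg : ∀ e, o ∈ ends e → e = g₁ ∨ e = g₂)
    (ho1 : o ≠ a₁) (ho2 : o ≠ a₂) (x : Config E) (h1 : x g₁ = false) (h2 : x g₂ = false) :
    (st ends o a₁ a₂ a₃ b x).Lo = false ∧ (st ends o a₁ a₂ a₃ b x).Ho = false := by
  have hcl : ∀ e', e' ≠ g₂ → o ∈ ends e' → x e' = false := by
    intro e' hne ho'
    rcases hdeg e' ho' with rfl | rfl
    · exact h1
    · exact absurd rfl hne
  have _hg₁ := hg₁
  refine ⟨decide_eq_false fun h => ho1 ?_, decide_eq_false fun h => ho2 ?_⟩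
  · exact (conn_closed_at_eq hg₂ hcl h2 (conn_symm h)).symm
  · exact (conn_closed_at_eq hg₂ hcl h2 (conn_symm h)).symm

omit [Fintype E] in
/-- A copy of a two-edge `o` is `o`-inert unless `g₁` is open and `g₂` closed. -/
lemma st_oInert {g₁ g₂ : E} {v : V} (hg₁ : ends g₁ = s(o, v))
    (hg₂ : ends g₂ = s(o, a₃)) (hdeg : ∀ e, o ∈ ends e → e = g₁ ∨ e = g₂)
    (ho1 : o ≠ a₁) (ho2 : o ≠ a₂) (x : Config E) (h : x g₁ = false ∨ x g₂ = true) :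
    ((st ends o a₁ a₂ a₃ b x).Lo = false ∧ (st ends o a₁ a₂ a₃ b x).Ho = false) ∨
      ((st ends o a₁ a₂ a₃ b x).Lo = (st ends o a₁ a₂ a₃ b x).L3 ∧
        (st ends o a₁ a₂ a₃ b x).Ho = (st ends o a₁ a₂ a₃ b x).H3) := by
  by_cases h2 : x g₂ = true
  · exact Or.inr (st_coinc_of_open ends o a₁ a₂ a₃ b hg₂ x h2)
  · have h2' : x g₂ = false := by simpa using h2
    rcases h with h1 | h1
    · exact Or.inl (st_isolated_of_closed ends o a₁ a₂ a₃ b hg₁ hg₂ hdeg ho1 ho2 x h1 h2')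
    · exact absurd h1 h2

omit [Fintype E] in
/-- With `g₁` closed, the state of `g₂` does not affect the non-`o` data. -/
lemma killO_st_update_g₂ {g₁ g₂ : E} {v : V} (hg₁ : ends g₁ = s(o, v))
    (hg₂ : ends g₂ = s(o, a₃)) (hdeg : ∀ e, o ∈ ends e → e = g₁ ∨ e = g₂)
    (ho1 : o ≠ a₁) (ho2 : o ≠ a₂) (ho3 : o ≠ a₃) (hob : o ≠ b) (x : Config E) (h1 : x g₁ = false) :
    killO (st ends o a₁ a₂ a₃ b x) = killO (st ends o a₁ a₂ a₃ b (Function.update x g₂ false)) := by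
  have hcl : ∀ e', e' ≠ g₂ → o ∈ ends e' → x e' = false := by
    intro e' hne ho'
    rcases hdeg e' ho' with rfl | rfl
    · exact h1
    · exact absurd rfl hne
  have _hg₁ := hg₁
  have key : ∀ p q : V, p ≠ o → q ≠ o →
      (Conn ends x p q ↔ Conn ends (Function.update x g₂ false) p q) := by
    intro p q hp hq
    have := conn_update_closed_at_iff hg₂ ho3 hcl (x g₂) hp hq
    rwa [Function.update_eq_self] at this
  unfold killO st
  simp only [Prod.mk.injEq]
  exact ⟨decide_eq_decide.mpr (key a₂ a₁ ho2.symm ho1.symm), trivial, trivial,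
    decide_eq_decide.mpr (key a₁ b ho1.symm hob.symm),
    decide_eq_decide.mpr (key a₂ b ho2.symm hob.symm),
    decide_eq_decide.mpr (key a₁ a₃ ho1.symm ho3.symm),
    decide_eq_decide.mpr (key a₂ a₃ ho2.symm ho3.symm)⟩

omit [Fintype E] in
/-- With `g₂` closed, closing `g₁` isolates `o` and changes nothing else. -/
lemma st_update_g₁_of_closed {g₁ g₂ : E} {v : V} (hg₁ : ends g₁ = s(o, v))
    (hg₂ : ends g₂ = s(o, a₃)) (hdeg : ∀ e, o ∈ ends e → e = g₁ ∨ e = g₂)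
    (hov : o ≠ v) (ho1 : o ≠ a₁) (ho2 : o ≠ a₂) (ho3 : o ≠ a₃) (hob : o ≠ b)
    (x : Config E) (h2 : x g₂ = false) :
    st ends o a₁ a₂ a₃ b (Function.update x g₁ false) =
      killO (st ends o a₁ a₂ a₃ b (Function.update x g₁ true)) := by
  have hcl : ∀ e', e' ≠ g₁ → o ∈ ends e' → x e' = false := by
    intro e' hne ho'
    rcases hdeg e' ho' with rfl | rfl
    · exact absurd rfl hne
    · exact h2
  have hcl' : ∀ e', e' ≠ g₁ → o ∈ ends e' → Function.update x g₁ false e' = false := by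
    intro e' hne ho'
    rw [Function.update_of_ne hne]
    exact hcl e' hne ho'
  have hωe : Function.update x g₁ false g₁ = false := Function.update_self g₁ false x
  have key : ∀ p q : V, p ≠ o → q ≠ o →
      (Conn ends (Function.update x g₁ false) p q ↔
        Conn ends (Function.update x g₁ true) p q) :=
    fun p q hp hq => (conn_update_closed_at_iff hg₁ hov hcl true hp hq).symm
  have _hg₂ := hg₂
  unfold killO st
  simp only [Prod.mk.injEq]
  refine ⟨decide_eq_decide.mpr (key a₂ a₁ ho2.symm ho1.symm),
    decide_eq_false fun h => ho1 (conn_closed_at_eq hg₁ hcl' hωe (conn_symm h)).symm,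
    decide_eq_false fun h => ho2 (conn_closed_at_eq hg₁ hcl' hωe (conn_symm h)).symm,
    decide_eq_decide.mpr (key a₁ b ho1.symm hob.symm),
    decide_eq_decide.mpr (key a₂ b ho2.symm hob.symm),
    decide_eq_decide.mpr (key a₁ a₃ ho1.symm ho3.symm),
    decide_eq_decide.mpr (key a₂ a₃ ho2.symm ho3.symm)⟩

end Config

end TypedRed

end CovForm

end Summit.Ventures.PercRepro2

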